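import Summits.CriticalPhenomena.CardyFormulaZ2.Theorems.CardyBoundaryCoulombGasHalfPlaneMarkDensityLawTwoArmPoint
import Summits.CriticalPhenomena.CardyFormulaZ2.Theorems.CardyBoundaryCoulombGasHalfPlaneMarkDensityLawConversePart1
import Summits.CriticalPhenomena.CardyFormulaZ2.Theorems.CardyBoundaryCoulombGasHalfPlaneMarkDensityLawConverseAnalysis
import Mathlib.Analysis.SpecialFunctions.Pow.Continuity

/-!
# Line `Sketch`, converse direction — conclusion (crux `HalfPlaneMarkDensityLaw`, stmt-CriticalPhenomena-5661):
# `HalfPlaneMarkDensityLaw → C⁺` unconditionally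

Glue of the three landed pieces: the two-arm point bound (STUB A, `stub_twoArmPoint`) gives the
DOMINATION of the step densities on `(x,∞)` (`Converse.measureReal_firstHit_le_of_twoArm`), the RSW
annulus decay gives the SHORT-ARC bound (`stub_shortArc`), and the analysis file turns the crux plus
these two inputs into the collinear half-plane Cardy CDF (`stub_lawGivesCDF`).  Result
(`stub_converse`): the crux IMPLIES C⁺; together with the line's reduction `C⁺ → crux` the crux is
EXACTLY the collinear half-plane Cardy law for bond-`ℤ²`.
-/

noncomputable section

namespace Summit.CriticalPhenomena.CardyFormulaZ2.Cruxes.HalfPlaneMarkDensityLaw.SketchLine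

open Literature.Probability.Percolation Literature.Probability.LatticeModels
open Literature.Probability.RandomPlanarGeometry
open MeasureTheory Filter Set
open scoped Topology ENNReal
open Summit.CriticalPhenomena.CardyFormulaZ2.Theses.CardyBoundaryCoulombGas (HalfPlaneMarkDensityLaw)
open Summit.CriticalPhenomena.CardyFormulaZ2.Theorems.HalfPlaneMarkDensityLaw.Negative

namespace Converse

/-- **Domination from the two-arm point bound**: for `c < x` there are `D` and `n₁` with
`stepDensity a b c n t ≤ D` for all `n ≥ n₁` and `t > x` (half-box radius `R = ⌊(x−c)n/2⌋`,
`P[E(⌊tn⌋)] ≤ C/R`, so `n·P ≤ 4C/(x−c)`). [folklore] -/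
theorem hdom_of_twoArm {C : ℝ}
    (hA : ∀ (k : ℤ) (R : ℕ), 1 ≤ R →
      μ.real (openCrossing {v : Site 2 | 0 ≤ v 1 ∧ v 1 ≤ (R : ℤ) ∧ k - R ≤ v 0 ∧ v 0 ≤ k + R} {bpt k}
            {v : Site 2 | v 0 = k - R ∨ v 0 = k + R ∨ v 1 = (R : ℤ)} \
          openCrossing {v : Site 2 | 0 ≤ v 1 ∧ v 1 ≤ (R : ℤ) ∧ k - R ≤ v 0 ∧ v 0 ≤ k + R}
            (rowIcc (k - R) (k - 1)) {bpt k}) ≤ C / R)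
    {a b c x : ℝ} (hbc : b < c) (hcx : c < x) :
    ∃ D : ℝ, ∃ n₁ : ℕ, ∀ n : ℕ, n₁ ≤ n → ∀ t : ℝ, x < t → stepDensity a b c n t ≤ ENNReal.ofReal D := by
  have hC0 : 0 ≤ C := by
    have h := hA 0 1 le_rfl
    simp only [Nat.cast_one, div_one] at h
    exact le_trans measureReal_nonneg h
  set ρ : ℝ := (x - c) / 2 with hρ
  have hρ0 : 0 < ρ := by rw [hρ]; linarith
  have hxbρ : 0 < x - b - ρ := by rw [hρ]; linarith
  have h1 : ∀ᶠ n : ℕ in atTop, (2 : ℝ) ≤ ρ * n :=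
    (tendsto_natCast_atTop_atTop.const_mul_atTop hρ0).eventually_ge_atTop _
  have h2 : ∀ᶠ n : ℕ in atTop, (2 : ℝ) ≤ (x - b - ρ) * n :=
    (tendsto_natCast_atTop_atTop.const_mul_atTop hxbρ).eventually_ge_atTop _
  obtain ⟨n₁, hn₁⟩ := eventually_atTop.1 (h1.and h2)
  refine ⟨2 * C / ρ, n₁, fun n hn t hxt ↦ ?_⟩
  obtain ⟨hρn, hxbn⟩ := hn₁ n hn
  have hn0 : (0 : ℝ) < n := by
    by_contra h
    push Not at h
    nlinarith
  set R : ℕ := ⌊ρ * n⌋₊ with hR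
  have hRle : (R : ℝ) ≤ ρ * n := Nat.floor_le (by positivity)
  have hRge : ρ * n - 1 ≤ R := by
    have := Nat.lt_floor_add_one (ρ * n); rw [← hR] at this; linarith
  have hR1 : 1 ≤ R := by
    have : (1 : ℝ) ≤ R := by linarith
    exact_mod_cast this
  set k : ℤ := ⌊t * n⌋ with hk
  -- the side conditions of the inclusion `E(k) ⊆ liso k R`
  have hkt : t * n - 1 < k := by rw [hk]; have := Int.lt_floor_add_one (t * n); linarith
  have hβ : ⌊b * (n : ℝ)⌋ < k - R := by
    have hb := Int.floor_le (b * n)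
    have : ((⌊b * (n : ℝ)⌋ : ℤ) : ℝ) + R < k := by nlinarith
    have h' : ⌊b * (n : ℝ)⌋ + (R : ℤ) < k := by exact_mod_cast this
    omega
  have hγ : ⌊c * (n : ℝ)⌋ ≤ k - R := by
    have hc := Int.floor_le (c * n)
    have hρ' : x - c - ρ = ρ := by rw [hρ]; ring
    have : ((⌊c * (n : ℝ)⌋ : ℤ) : ℝ) + R ≤ k := by nlinarith
    have h' : ⌊c * (n : ℝ)⌋ + (R : ℤ) ≤ k := by exact_mod_cast this
    omega
  have hP := measureReal_firstHit_le_of_twoArm hA (α := ⌊a * (n : ℝ)⌋) hR1 hβ hγ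
  -- `stepDensity = ofReal (n · P[E(k)])`
  have hstep : stepDensity a b c n t = ENNReal.ofReal ((n : ℝ) * μ.real (markEvent a b c t n)) := by
    rw [stepDensity, ENNReal.ofReal_mul (Nat.cast_nonneg n), ENNReal.ofReal_natCast, measureReal_def,
      ENNReal.ofReal_toReal (measure_ne_top μ _)]
  rw [hstep]
  refine ENNReal.ofReal_le_ofReal ?_
  rw [markEvent_eq_firstHit]
  have hR0 : (0 : ℝ) < R := by exact_mod_cast hR1
  calc (n : ℝ) * μ.real (firstHit halfPlane (arcA a b n) ⌊c * n⌋ ⌊t * n⌋) ≤ n * (C / R) :=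
        mul_le_mul_of_nonneg_left hP hn0.le
    _ ≤ 2 * C / ρ := by
        rw [mul_div_assoc', div_le_div_iff₀ hR0 hρ0]
        nlinarith [mul_nonneg hC0 hn0.le]

end Converse

open Converse in
/-- **`HalfPlaneMarkDensityLaw → C⁺`** (registered extra stub `stub_converse` of the line): the crux
implies the collinear half-plane Cardy law for bond-`ℤ²` — unconditionally (two-arm point bound, RSW
annulus decay, reverse Fatou). [folklore] -/
theorem stub_converse :
    HalfPlaneMarkDensityLaw → ∀ a b c y : ℝ, a < b → b < c → c < y →
      Tendsto (fun n : ℕ ↦ μ.real (openCrossing halfPlane (arcA a b n) (rowIcc ⌊c * n⌋ ⌊y * n⌋))) atTop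
        (𝓝 (Literature.Probability.RandomPlanarGeometry.cardyFunction
          (Literature.Probability.RandomPlanarGeometry.crossRatio ![a, b, c, y]))) := by
  intro hlaw a b c y hab hbc hcy
  obtain ⟨C, hA⟩ := stub_twoArmPoint
  obtain ⟨α, hα, hshort⟩ := stub_shortArc
  refine stub_lawGivesCDF hlaw a b c y hab hbc hcy
    (fun x hcx ↦ hdom_of_twoArm (fun k R hR ↦ (hA k R hR).1) hbc hcx)
    (fun x ↦ (4 * (x - c) / (c - b)) ^ α) ?_ ?_
  · have h1 : Tendsto (fun x : ℝ ↦ 4 * (x - c) / (c - b)) (𝓝 c) (𝓝 0) := by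
      have hcont : Continuous fun x : ℝ ↦ 4 * (x - c) / (c - b) := by fun_prop
      have := hcont.tendsto c
      simpa using this
    have h2 := h1.rpow_const (p := α) (Or.inr hα.le)
    rw [Real.zero_rpow hα.ne'] at h2
    exact h2.mono_left nhdsWithin_le_nhds
  · have hI : ∀ᶠ x : ℝ in 𝓝[>] c, x ∈ Ioo c (c + (c - b) / 8) := Ioo_mem_nhdsGT (by linarith)
    filter_upwards [hI] with x hx
    exact hshort a b c x hab hbc hx.1 (by linarith [hx.2])

end Summit.CriticalPhenomena.CardyFormulaZ2.Cruxes.HalfPlaneMarkDensityLaw.SketchLine
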